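import Summits.BirchSwinnertonDyer.Rank1Residual.P2.CMKolyvaginTamagawaIndexOddHeegner
import HarnessLib

/-!
# Crux `InertOddHeegnerJOfFacts` (stmt-BirchSwinnertonDyer-20672, leaf `WAllCornerFTwo`): the Tamagawa
# index `t = v₂(∏ c_ℓ)` on the FIVE BASES `cm11, cm19, cm43, cm67, cm163` and all their twists —
# `t = 1 ⟺ d` is `q`-silent, by base

Cell `bsd-print-cf2`, seat ty2 (discharge interface), helper for crux stmt-BirchSwinnertonDyer-20672
(route `PrintCf2`; idea card `tamagawa-shifted-kolyvagin` of the cell planner, 2026-08-28); companion of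
`CMKolyvaginTamagawaIndexOddHeegner.lean` (the generic criterion
`OddHeegnerTwists.padicValNat_two_tamagawaProduct_twist_eq_one_iff`). HONEST FRAMING: THEOREMS ONLY — no
definition, no named fact, no route file imported, nothing about BSD asserted or booked; the leaf and
the crux are OPEN; BSD is not proved by any of this.

For each odd-inert CM base `cm_q = (0, a₂, 1, a₄, a₆)` (`q ∈ {11, 19, 43, 67, 163}`; Cremona `121b1`,
`361a1`, `1849a1`, `4489a1`, `26569a1`; Silverman *ATAEC* App. A §3): global minimality (`Δ = −q³`), the
integer model, and for `d ≠ 0` square-free and EVERY model `W'` of `cm_q^{(d)}`: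

* **`padicValNat_two_tamagawaProduct_twist_cm11_eq_one_iff`**: `v₂(∏ c_ℓ(W')) = 1 ⟺` no prime
  `p ∣ d`, `p ∤ 2·11`, has a root of `4x³ − 4x² − 28x + 41` mod `p`; likewise `…_cm19_…`
  (`4x³ − 152x + 361`), `…_cm43_…` (`4x³ − 3440x + 38829`), `…_cm67_…` (`4x³ − 29480x + 974113`),
  `…_cm163_…` (`4x³ − 8697680x + 4936546769`);
* `one_le_padicValNat_two_tamagawaProduct_twist` — `t ≥ 1` on every model of every twist;
* `padicValNat_two_tamagawaProduct_cm11` … `_cm163` — `t = 1` for the five untwisted bases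
  (`∏ c_ℓ = c_q = 2`);
* §4 `shiftedHabitat_of_j_oddHeegner` / `shiftedHabitat_twist` — «20672 = the habitat of L8 with
  `t ≥ 1`»: every curve with one of the five `j` (every twist, every model) has CM, `2` inert,
  `ρ̄_{E,2}` onto `GL₂(𝔽₂)` and `t ≥ 1`.

Numerical cross-check (EVIDENCE, not used): kit j297287 (PARI `ellglobalred`/`elllocalred` on all
square-free `|d| ≤ 2000` of both signs, `2430` twists per base, `12150` curves): `c_q = 2` in
`12150/12150`; `t = 1 ⟺ d` `q`-silent in `12150/12150` (0 mismatches); `#{t = 1} = 634, 566, 478, 422,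
296` for `q = 11, 19, 43, 67, 163`; `t ∈ {1,…,5}` throughout; the five bases have `∏ c_ℓ = 2`.

References: G. Boxer–P. Diao, Proc. AMS 138 (2010), proof of Prop. 4.1 (pp. 1976–1977) [BoxerDiao2010];
Silverman *ATAEC* IV.9.4 and Table 4.1, App. A §3 [SilvermanATAEC1994]; Silverman *AEC* VII.1 Remark 1.1,
X.5 Prop. 5.4 [SilvermanAEC2009]; Cremona's tables (121b1, 361a1, 1849a1, 4489a1, 26569a1) [Cremona1997].
-/

set_option autoImplicit false

noncomputable section

open scoped Classical NumberField

open WeierstrassCurve NumberField IsDedekindDomain IsDedekindDomain.HeightOneSpectrum Rat.HeightOneSpectrum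
  Literature.NumberTheory.EllipticCurves Literature.NumberTheory.EllipticCurves.BoxerDiao2010
  Literature.NumberTheory.EllipticCurves.Rank1Residual
  Literature.NumberTheory.EllipticCurves.Rank1Residual.X11RankOneCertificates
  Summit.BirchSwinnertonDyer.Rank1Residual Summit.BirchSwinnertonDyer.Rank1Residual.P2

namespace Summit.BirchSwinnertonDyer.Rank1Residual.P2.OddHeegnerTwists

/-! ## §3 The five odd-Heegner bases `cm11, cm19, cm43, cm67, cm163` -/

section Bases

/-- `cm11 = 121b1 = (0,−1,1,−7,10)` is a global minimal model (`Δ = −11³`).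
[cite: Cremona1997, Table 1 (121b1)] [cite: SilvermanAEC2009, VII.1 Remark 1.1] -/
theorem isGloballyMinimal_cm11 : cm11.IsGloballyMinimal := by
  have e : cm11 = ⟨((0 : ℤ) : ℚ), ((-1 : ℤ) : ℚ), ((1 : ℤ) : ℚ), ((-7 : ℤ) : ℚ), ((10 : ℤ) : ℚ)⟩ := by
    ext <;> simp
  rw [e]
  refine isGloballyMinimal_of_int_criterion 0 (-1) 1 (-7) 10 fun p hp hboth => ?_
  have hΔ : discOf [0, -1, 1, -7, 10] = -((11 : ℕ) : ℤ) ^ 3 := by decide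
  exact not_pow_twelve_dvd_neg_prime_cube (by norm_num) hp (hΔ ▸ hboth.1)

/-- `cm19 = 361a1 = (0,0,1,−38,90)` is a global minimal model (`Δ = −19³`).
[cite: Cremona1997, Table 1 (361a1)] [cite: SilvermanAEC2009, VII.1 Remark 1.1] -/
theorem isGloballyMinimal_cm19 : cm19.IsGloballyMinimal := by
  have e : cm19 = ⟨((0 : ℤ) : ℚ), ((0 : ℤ) : ℚ), ((1 : ℤ) : ℚ), ((-38 : ℤ) : ℚ), ((90 : ℤ) : ℚ)⟩ := by
    ext <;> simp
  rw [e]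
  refine isGloballyMinimal_of_int_criterion 0 0 1 (-38) 90 fun p hp hboth => ?_
  have hΔ : discOf [0, 0, 1, -38, 90] = -((19 : ℕ) : ℤ) ^ 3 := by decide
  exact not_pow_twelve_dvd_neg_prime_cube (by norm_num) hp (hΔ ▸ hboth.1)

/-- `cm43 = 1849a1 = (0,0,1,−860,9707)` is a global minimal model (`Δ = −43³`).
[cite: Cremona1997, Table 1 (1849a1)] [cite: SilvermanAEC2009, VII.1 Remark 1.1] -/
theorem isGloballyMinimal_cm43 : cm43.IsGloballyMinimal := by
  have e : cm43 = ⟨((0 : ℤ) : ℚ), ((0 : ℤ) : ℚ), ((1 : ℤ) : ℚ), ((-860 : ℤ) : ℚ), ((9707 : ℤ) : ℚ)⟩ := by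
    ext <;> simp
  rw [e]
  refine isGloballyMinimal_of_int_criterion 0 0 1 (-860) 9707 fun p hp hboth => ?_
  have hΔ : discOf [0, 0, 1, -860, 9707] = -((43 : ℕ) : ℤ) ^ 3 := by decide
  exact not_pow_twelve_dvd_neg_prime_cube (by norm_num) hp (hΔ ▸ hboth.1)

/-- `cm67 = 4489a1 = (0,0,1,−7370,243528)` is a global minimal model (`Δ = −67³`).
[cite: Cremona1997, Table 1 (4489a1)] [cite: SilvermanAEC2009, VII.1 Remark 1.1] -/
theorem isGloballyMinimal_cm67 : cm67.IsGloballyMinimal := by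
  have e : cm67 =
      ⟨((0 : ℤ) : ℚ), ((0 : ℤ) : ℚ), ((1 : ℤ) : ℚ), ((-7370 : ℤ) : ℚ), ((243528 : ℤ) : ℚ)⟩ := by
    ext <;> simp
  rw [e]
  refine isGloballyMinimal_of_int_criterion 0 0 1 (-7370) 243528 fun p hp hboth => ?_
  have hΔ : discOf [0, 0, 1, -7370, 243528] = -((67 : ℕ) : ℤ) ^ 3 := by decide
  exact not_pow_twelve_dvd_neg_prime_cube (by norm_num) hp (hΔ ▸ hboth.1)

/-- `cm163 = 26569a1 = (0,0,1,−2174420,1234136692)` is a global minimal model (`Δ = −163³`).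
[cite: Cremona1997, Table 1 (26569a1)] [cite: SilvermanAEC2009, VII.1 Remark 1.1] -/
theorem isGloballyMinimal_cm163 : cm163.IsGloballyMinimal := by
  have e : cm163 =
      ⟨((0 : ℤ) : ℚ), ((0 : ℤ) : ℚ), ((1 : ℤ) : ℚ), ((-2174420 : ℤ) : ℚ), ((1234136692 : ℤ) : ℚ)⟩ := by
    ext <;> simp
  rw [e]
  refine isGloballyMinimal_of_int_criterion 0 0 1 (-2174420) 1234136692 fun p hp hboth => ?_
  have hΔ : discOf [0, 0, 1, -2174420, 1234136692] = -((163 : ℕ) : ℤ) ^ 3 := by decide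
  exact not_pow_twelve_dvd_neg_prime_cube (by norm_num) hp (hΔ ▸ hboth.1)

/-- The integer minimal model of `cm11` is `(0,−1,1,−7,10)` itself. [cite: Cremona1997, Table 1 (121b1)] -/
theorem integralModelInt_cm11 :
    (haveI := isGloballyMinimal_cm11; integralModelInt cm11) = ⟨0, -1, 1, -7, 10⟩ := by
  haveI := isGloballyMinimal_cm11
  apply WeierstrassCurve.map_injective (f := Int.castRingHom ℚ) Int.cast_injective
  dsimp only
  rw [map_integralModelInt]
  ext <;> simp [WeierstrassCurve.map]

/-- The integer minimal model of `cm19` is `(0,0,1,−38,90)` itself. [cite: Cremona1997, Table 1 (361a1)] -/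
theorem integralModelInt_cm19 :
    (haveI := isGloballyMinimal_cm19; integralModelInt cm19) = ⟨0, 0, 1, -38, 90⟩ := by
  haveI := isGloballyMinimal_cm19
  apply WeierstrassCurve.map_injective (f := Int.castRingHom ℚ) Int.cast_injective
  dsimp only
  rw [map_integralModelInt]
  ext <;> simp [WeierstrassCurve.map]

/-- The integer minimal model of `cm43` is `(0,0,1,−860,9707)` itself. [cite: Cremona1997, Table 1 (1849a1)] -/
theorem integralModelInt_cm43 :
    (haveI := isGloballyMinimal_cm43; integralModelInt cm43) = ⟨0, 0, 1, -860, 9707⟩ := by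
  haveI := isGloballyMinimal_cm43
  apply WeierstrassCurve.map_injective (f := Int.castRingHom ℚ) Int.cast_injective
  dsimp only
  rw [map_integralModelInt]
  ext <;> simp [WeierstrassCurve.map]

/-- The integer minimal model of `cm67` is `(0,0,1,−7370,243528)` itself. [cite: Cremona1997, Table 1 (4489a1)] -/
theorem integralModelInt_cm67 :
    (haveI := isGloballyMinimal_cm67; integralModelInt cm67) = ⟨0, 0, 1, -7370, 243528⟩ := by
  haveI := isGloballyMinimal_cm67
  apply WeierstrassCurve.map_injective (f := Int.castRingHom ℚ) Int.cast_injective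
  dsimp only
  rw [map_integralModelInt]
  ext <;> simp [WeierstrassCurve.map]

/-- The integer minimal model of `cm163` is `(0,0,1,−2174420,1234136692)` itself. [cite: Cremona1997, Table 1 (26569a1)] -/
theorem integralModelInt_cm163 :
    (haveI := isGloballyMinimal_cm163; integralModelInt cm163) = ⟨0, 0, 1, -2174420, 1234136692⟩ := by
  haveI := isGloballyMinimal_cm163
  apply WeierstrassCurve.map_injective (f := Int.castRingHom ℚ) Int.cast_injective
  dsimp only
  rw [map_integralModelInt]
  ext <;> simp [WeierstrassCurve.map]

/-- `Δ` of the integer model of `cm11`: `−11³`. [cite: Cremona1997, Table 1 (121b1)] -/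
theorem Δ_cm11_int : (⟨0, -1, 1, -7, 10⟩ : WeierstrassCurve ℤ).Δ = -((11 : ℕ) : ℤ) ^ 3 := by
  norm_num [WeierstrassCurve.Δ, WeierstrassCurve.b₂, WeierstrassCurve.b₄, WeierstrassCurve.b₆,
    WeierstrassCurve.b₈]

/-- `Δ` of the integer model of `cm19`: `−19³`. [cite: Cremona1997, Table 1 (361a1)] -/
theorem Δ_cm19_int : (⟨0, 0, 1, -38, 90⟩ : WeierstrassCurve ℤ).Δ = -((19 : ℕ) : ℤ) ^ 3 := by
  norm_num [WeierstrassCurve.Δ, WeierstrassCurve.b₂, WeierstrassCurve.b₄, WeierstrassCurve.b₆,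
    WeierstrassCurve.b₈]

/-- `Δ` of the integer model of `cm43`: `−43³`. [cite: Cremona1997, Table 1 (1849a1)] -/
theorem Δ_cm43_int : (⟨0, 0, 1, -860, 9707⟩ : WeierstrassCurve ℤ).Δ = -((43 : ℕ) : ℤ) ^ 3 := by
  norm_num [WeierstrassCurve.Δ, WeierstrassCurve.b₂, WeierstrassCurve.b₄, WeierstrassCurve.b₆,
    WeierstrassCurve.b₈]

/-- `Δ` of the integer model of `cm67`: `−67³`. [cite: Cremona1997, Table 1 (4489a1)] -/
theorem Δ_cm67_int : (⟨0, 0, 1, -7370, 243528⟩ : WeierstrassCurve ℤ).Δ = -((67 : ℕ) : ℤ) ^ 3 := by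
  norm_num [WeierstrassCurve.Δ, WeierstrassCurve.b₂, WeierstrassCurve.b₄, WeierstrassCurve.b₆,
    WeierstrassCurve.b₈]

/-- `Δ` of the integer model of `cm163`: `−163³`. [cite: Cremona1997, Table 1 (26569a1)] -/
theorem Δ_cm163_int :
    (⟨0, 0, 1, -2174420, 1234136692⟩ : WeierstrassCurve ℤ).Δ = -((163 : ℕ) : ℤ) ^ 3 := by
  norm_num [WeierstrassCurve.Δ, WeierstrassCurve.b₂, WeierstrassCurve.b₄, WeierstrassCurve.b₆,
    WeierstrassCurve.b₈]

variable (W' : WeierstrassCurve ℚ) [W'.IsElliptic] {C : VariableChange ℚ} {d : ℤ}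

/-- Every model of a twist has the `j`-invariant of the base. [cite: SilvermanAEC2009, X.5 Prop. 5.4 and Cor. 5.4.1] -/
theorem j_of_twist {E : WeierstrassCurve ℚ} [E.IsElliptic] (hd0 : d ≠ 0)
    (hC : C • W' = E.quadraticTwist (d : ℚ)) : W'.j = E.j := by
  have hdq : (d : ℚ) ≠ 0 := by exact_mod_cast hd0
  exact CornerFTwo.Atlas.j_eq_of_smul_twist (W := W') hdq (C := C⁻¹) (by rw [← hC, inv_smul_smul])

/-- **`cm11 = 121b1`: for `d ≠ 0` square-free and EVERY model `W'` of `121b1^{(d)}`,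
`v₂(∏ c_ℓ(W')) = 1 ⟺` no prime `p ∣ d`, `p ∤ 22`, has a root of `4x³ − 4x² − 28x + 41` mod `p`.**
[cite: BoxerDiao2010, proof of Prop. 4.1 (pp. 1976–1977)] [cite: SilvermanATAEC1994, IV.9.4 and Table 4.1]
[cite: Cremona1997, Table 1 (121b1)] -/
theorem padicValNat_two_tamagawaProduct_twist_cm11_eq_one_iff (hd0 : d ≠ 0) (hsq : Squarefree d)
    (hC : C • W' = cm11.quadraticTwist (d : ℚ)) :
    padicValNat 2 W'.tamagawaProduct = 1 ↔
      ∀ p : ℕ, p.Prime → p ≠ 2 → p ≠ 11 → (p : ℤ) ∣ d →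
        ∀ x : ZMod p, 4 * x ^ 3 - 4 * x ^ 2 - 28 * x + 41 ≠ 0 := by
  haveI := isGloballyMinimal_cm11
  have h := padicValNat_two_tamagawaProduct_twist_eq_one_iff W' (B := cm11) rfl rfl
    integralModelInt_cm11 (by norm_num) Δ_cm11_int hd0 hsq hC
    (fun v hv => InertAtlas.kodairaSymbolAt_of_j_cm11 W' ((j_of_twist W' hd0 hC).trans j_cm11) v hv)
  rw [h]
  have e : ∀ (p : ℕ) (x : ZMod p), 4 * x ^ 3 + 4 * ((-1 : ℤ) : ZMod p) * x ^ 2 +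
      4 * ((-7 : ℤ) : ZMod p) * x + (4 * ((10 : ℤ) : ZMod p) + 1) = 4 * x ^ 3 - 4 * x ^ 2 - 28 * x + 41 := by
    intro p x; push_cast; ring
  simp_rw [e]

/-- **`cm19 = 361a1`: for `d ≠ 0` square-free and EVERY model `W'` of `361a1^{(d)}`,
`v₂(∏ c_ℓ(W')) = 1 ⟺` no prime `p ∣ d`, `p ∤ 38`, has a root of `4x³ − 152x + 361` mod `p`.**
[cite: BoxerDiao2010, proof of Prop. 4.1 (pp. 1976–1977)] [cite: SilvermanATAEC1994, IV.9.4 and Table 4.1]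
[cite: Cremona1997, Table 1 (361a1)] -/
theorem padicValNat_two_tamagawaProduct_twist_cm19_eq_one_iff (hd0 : d ≠ 0) (hsq : Squarefree d)
    (hC : C • W' = cm19.quadraticTwist (d : ℚ)) :
    padicValNat 2 W'.tamagawaProduct = 1 ↔
      ∀ p : ℕ, p.Prime → p ≠ 2 → p ≠ 19 → (p : ℤ) ∣ d →
        ∀ x : ZMod p, 4 * x ^ 3 - 152 * x + 361 ≠ 0 := by
  haveI := isGloballyMinimal_cm19
  have h := padicValNat_two_tamagawaProduct_twist_eq_one_iff W' (B := cm19) rfl rfl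
    integralModelInt_cm19 (by norm_num) Δ_cm19_int hd0 hsq hC
    (fun v hv => InertAtlas.kodairaSymbolAt_of_j_cm19 W' ((j_of_twist W' hd0 hC).trans j_cm19) v hv)
  rw [h]
  have e : ∀ (p : ℕ) (x : ZMod p), 4 * x ^ 3 + 4 * ((0 : ℤ) : ZMod p) * x ^ 2 +
      4 * ((-38 : ℤ) : ZMod p) * x + (4 * ((90 : ℤ) : ZMod p) + 1) = 4 * x ^ 3 - 152 * x + 361 := by
    intro p x; push_cast; ring
  simp_rw [e]

/-- **`cm43 = 1849a1`: for `d ≠ 0` square-free and EVERY model `W'` of `1849a1^{(d)}`,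
`v₂(∏ c_ℓ(W')) = 1 ⟺` no prime `p ∣ d`, `p ∤ 86`, has a root of `4x³ − 3440x + 38829` mod `p`.**
[cite: BoxerDiao2010, proof of Prop. 4.1 (pp. 1976–1977)] [cite: SilvermanATAEC1994, IV.9.4 and Table 4.1]
[cite: Cremona1997, Table 1 (1849a1)] -/
theorem padicValNat_two_tamagawaProduct_twist_cm43_eq_one_iff (hd0 : d ≠ 0) (hsq : Squarefree d)
    (hC : C • W' = cm43.quadraticTwist (d : ℚ)) :
    padicValNat 2 W'.tamagawaProduct = 1 ↔
      ∀ p : ℕ, p.Prime → p ≠ 2 → p ≠ 43 → (p : ℤ) ∣ d →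
        ∀ x : ZMod p, 4 * x ^ 3 - 3440 * x + 38829 ≠ 0 := by
  haveI := isGloballyMinimal_cm43
  have h := padicValNat_two_tamagawaProduct_twist_eq_one_iff W' (B := cm43) rfl rfl
    integralModelInt_cm43 (by norm_num) Δ_cm43_int hd0 hsq hC
    (fun v hv => InertAtlas.kodairaSymbolAt_of_j_cm43 W' ((j_of_twist W' hd0 hC).trans j_cm43) v hv)
  rw [h]
  have e : ∀ (p : ℕ) (x : ZMod p), 4 * x ^ 3 + 4 * ((0 : ℤ) : ZMod p) * x ^ 2 +
      4 * ((-860 : ℤ) : ZMod p) * x + (4 * ((9707 : ℤ) : ZMod p) + 1) = 4 * x ^ 3 - 3440 * x + 38829 := by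
    intro p x; push_cast; ring
  simp_rw [e]

/-- **`cm67 = 4489a1`: for `d ≠ 0` square-free and EVERY model `W'` of `4489a1^{(d)}`,
`v₂(∏ c_ℓ(W')) = 1 ⟺` no prime `p ∣ d`, `p ∤ 134`, has a root of `4x³ − 29480x + 974113` mod `p`.**
[cite: BoxerDiao2010, proof of Prop. 4.1 (pp. 1976–1977)] [cite: SilvermanATAEC1994, IV.9.4 and Table 4.1]
[cite: Cremona1997, Table 1 (4489a1)] -/
theorem padicValNat_two_tamagawaProduct_twist_cm67_eq_one_iff (hd0 : d ≠ 0) (hsq : Squarefree d)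
    (hC : C • W' = cm67.quadraticTwist (d : ℚ)) :
    padicValNat 2 W'.tamagawaProduct = 1 ↔
      ∀ p : ℕ, p.Prime → p ≠ 2 → p ≠ 67 → (p : ℤ) ∣ d →
        ∀ x : ZMod p, 4 * x ^ 3 - 29480 * x + 974113 ≠ 0 := by
  haveI := isGloballyMinimal_cm67
  have h := padicValNat_two_tamagawaProduct_twist_eq_one_iff W' (B := cm67) rfl rfl
    integralModelInt_cm67 (by norm_num) Δ_cm67_int hd0 hsq hC
    (fun v hv => InertAtlas.kodairaSymbolAt_of_j_cm67 W' ((j_of_twist W' hd0 hC).trans j_cm67) v hv)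
  rw [h]
  have e : ∀ (p : ℕ) (x : ZMod p), 4 * x ^ 3 + 4 * ((0 : ℤ) : ZMod p) * x ^ 2 +
      4 * ((-7370 : ℤ) : ZMod p) * x + (4 * ((243528 : ℤ) : ZMod p) + 1) =
        4 * x ^ 3 - 29480 * x + 974113 := by
    intro p x; push_cast; ring
  simp_rw [e]

/-- **`cm163 = 26569a1`: for `d ≠ 0` square-free and EVERY model `W'` of `26569a1^{(d)}`,
`v₂(∏ c_ℓ(W')) = 1 ⟺` no prime `p ∣ d`, `p ∤ 326`, has a root of `4x³ − 8697680x + 4936546769`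
mod `p`.** [cite: BoxerDiao2010, proof of Prop. 4.1 (pp. 1976–1977)] [cite: SilvermanATAEC1994, IV.9.4 and Table 4.1]
[cite: Cremona1997, Table 1 (26569a1)] -/
theorem padicValNat_two_tamagawaProduct_twist_cm163_eq_one_iff (hd0 : d ≠ 0) (hsq : Squarefree d)
    (hC : C • W' = cm163.quadraticTwist (d : ℚ)) :
    padicValNat 2 W'.tamagawaProduct = 1 ↔
      ∀ p : ℕ, p.Prime → p ≠ 2 → p ≠ 163 → (p : ℤ) ∣ d →
        ∀ x : ZMod p, 4 * x ^ 3 - 8697680 * x + 4936546769 ≠ 0 := by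
  haveI := isGloballyMinimal_cm163
  have h := padicValNat_two_tamagawaProduct_twist_eq_one_iff W' (B := cm163) rfl rfl
    integralModelInt_cm163 (by norm_num) Δ_cm163_int hd0 hsq hC
    (fun v hv => InertAtlas.kodairaSymbolAt_of_j_cm163 W' ((j_of_twist W' hd0 hC).trans j_cm163) v hv)
  rw [h]
  have e : ∀ (p : ℕ) (x : ZMod p), 4 * x ^ 3 + 4 * ((0 : ℤ) : ZMod p) * x ^ 2 +
      4 * ((-2174420 : ℤ) : ZMod p) * x + (4 * ((1234136692 : ℤ) : ZMod p) + 1) =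
        4 * x ^ 3 - 8697680 * x + 4936546769 := by
    intro p x; push_cast; ring
  simp_rw [e]

/-- **`t ≥ 1` on the five families:** every model of every twist of `cm11, cm19, cm43, cm67, cm163`
has `1 ≤ v₂(∏ c_ℓ)`. [cite: SilvermanATAEC1994, IV.9.4 Steps 4 and 9 and Table 4.1] [cite: Cremona1997, Table 1] -/
theorem one_le_padicValNat_two_tamagawaProduct_twist {E : WeierstrassCurve ℚ} [E.IsElliptic]
    (hE : E = cm11 ∨ E = cm19 ∨ E = cm43 ∨ E = cm67 ∨ E = cm163) (hd0 : d ≠ 0)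
    (hC : C • W' = E.quadraticTwist (d : ℚ)) : 1 ≤ padicValNat 2 W'.tamagawaProduct := by
  refine one_le_padicValNat_two_tamagawaProduct_of_j_oddHeegner W' ?_
  rw [j_of_twist W' hd0 hC]
  rcases hE with rfl | rfl | rfl | rfl | rfl
  · exact Or.inl j_cm11
  · exact Or.inr (Or.inl j_cm19)
  · exact Or.inr (Or.inr (Or.inl j_cm43))
  · exact Or.inr (Or.inr (Or.inr (Or.inl j_cm67)))
  · exact Or.inr (Or.inr (Or.inr (Or.inr j_cm163)))

/-- **`t(121b1) = 1`.** [cite: Cremona1997, Table 1 (121b1: c₁₁ = 2)] -/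
theorem padicValNat_two_tamagawaProduct_cm11 : padicValNat 2 cm11.tamagawaProduct = 1 := by
  obtain ⟨C, hC⟩ := cm11.exists_variableChange_quadraticTwist_one
  have h := padicValNat_two_tamagawaProduct_twist_cm11_eq_one_iff cm11 (d := 1) one_ne_zero
    squarefree_one (C := C) (by rw [hC]; norm_num)
  exact h.mpr fun p hp _ _ hpd => absurd (Int.eq_one_of_dvd_one (by positivity) hpd)
    (by exact_mod_cast hp.one_lt.ne')

/-- **`t(361a1) = 1`.** [cite: Cremona1997, Table 1 (361a1: c₁₉ = 2)] -/
theorem padicValNat_two_tamagawaProduct_cm19 : padicValNat 2 cm19.tamagawaProduct = 1 := by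
  obtain ⟨C, hC⟩ := cm19.exists_variableChange_quadraticTwist_one
  have h := padicValNat_two_tamagawaProduct_twist_cm19_eq_one_iff cm19 (d := 1) one_ne_zero
    squarefree_one (C := C) (by rw [hC]; norm_num)
  exact h.mpr fun p hp _ _ hpd => absurd (Int.eq_one_of_dvd_one (by positivity) hpd)
    (by exact_mod_cast hp.one_lt.ne')

/-- **`t(1849a1) = 1`.** [cite: Cremona1997, Table 1 (1849a1: c₄₃ = 2)] -/
theorem padicValNat_two_tamagawaProduct_cm43 : padicValNat 2 cm43.tamagawaProduct = 1 := by
  obtain ⟨C, hC⟩ := cm43.exists_variableChange_quadraticTwist_one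
  have h := padicValNat_two_tamagawaProduct_twist_cm43_eq_one_iff cm43 (d := 1) one_ne_zero
    squarefree_one (C := C) (by rw [hC]; norm_num)
  exact h.mpr fun p hp _ _ hpd => absurd (Int.eq_one_of_dvd_one (by positivity) hpd)
    (by exact_mod_cast hp.one_lt.ne')

/-- **`t(4489a1) = 1`.** [cite: Cremona1997, Table 1 (4489a1: c₆₇ = 2)] -/
theorem padicValNat_two_tamagawaProduct_cm67 : padicValNat 2 cm67.tamagawaProduct = 1 := by
  obtain ⟨C, hC⟩ := cm67.exists_variableChange_quadraticTwist_one
  have h := padicValNat_two_tamagawaProduct_twist_cm67_eq_one_iff cm67 (d := 1) one_ne_zero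
    squarefree_one (C := C) (by rw [hC]; norm_num)
  exact h.mpr fun p hp _ _ hpd => absurd (Int.eq_one_of_dvd_one (by positivity) hpd)
    (by exact_mod_cast hp.one_lt.ne')

/-- **`t(26569a1) = 1`.** [cite: Cremona1997, Table 1 (26569a1: c₁₆₃ = 2)] -/
theorem padicValNat_two_tamagawaProduct_cm163 : padicValNat 2 cm163.tamagawaProduct = 1 := by
  obtain ⟨C, hC⟩ := cm163.exists_variableChange_quadraticTwist_one
  have h := padicValNat_two_tamagawaProduct_twist_cm163_eq_one_iff cm163 (d := 1) one_ne_zero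
    squarefree_one (C := C) (by rw [hC]; norm_num)
  exact h.mpr fun p hp _ _ hpd => absurd (Int.eq_one_of_dvd_one (by positivity) hpd)
    (by exact_mod_cast hp.one_lt.ne')

end Bases

/-! ## §4 The shifted habitat of the card on rows (d)–(h), in `j`-currency -/

section Shifted

variable (W : WeierstrassCurve ℚ) [W.IsElliptic]

/-- **«20672 = the habitat of L8 with `t ≥ 1`» — the arithmetic part, for EVERY curve over `ℚ` with one
of the five odd-Heegner `j`-invariants (all twists of `121b1, 361a1, 1849a1, 4489a1, 26569a1`, every
model):** CM with `2` inert in the CM field, `ρ̄_{E,2}` onto `GL₂(𝔽₂)`, and Tamagawa index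
`t = v₂(∏ c_ℓ) ≥ 1` (so `Odd ∏ c_ℓ` — the one habitat binder of route `CMKolyvaginAtInertTwo` that
fails — fails by exactly the CM prime when `d` is `q`-silent). [cite: SilvermanATAEC1994, App. A §3 and IV.9.4 Table 4.1]
[cite: DokchitserDokchitserMathZ2012, Theorem (1)] [cite: Cox2013, §5.B Prop. 5.16 and Cor. 5.17] -/
theorem shiftedHabitat_of_j_oddHeegner
    (hj : W.j = -32768 ∨ W.j = -884736 ∨ W.j = -884736000 ∨ W.j = -147197952000 ∨
      W.j = -262537412640768000) :
    W.HasCM ∧ CMInert W 2 ∧ W.HasSurjectiveModNGaloisRep 2 ∧ 1 ≤ padicValNat 2 W.tamagawaProduct := by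
  obtain ⟨hCM, hin⟩ := CornerFTwo.hasCM_and_cmInert_two_of_j (W := W) (Or.inr (Or.inr hj))
  have hj0 : W.j ≠ 0 := by rcases hj with h | h | h | h | h <;> rw [h] <;> norm_num
  have hj54 : W.j ≠ 54000 := by rcases hj with h | h | h | h | h <;> rw [h] <;> norm_num
  exact ⟨hCM, hin, (hasSurjectiveModNGaloisRep_two_iff_of_cmInert_two_of_j_ne_zero W hCM hin hj0).mpr hj54,
    one_le_padicValNat_two_tamagawaProduct_of_j_oddHeegner W hj⟩

/-- Model form on the five twist families: every model `W'` of `cm_q^{(d)}` (`d ≠ 0`) has CM, `2` inert,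
`ρ̄₂` onto and `t ≥ 1`. [cite: SilvermanATAEC1994, App. A §3 and IV.9.4 Table 4.1] [cite: DokchitserDokchitserMathZ2012, Theorem (1)] -/
theorem shiftedHabitat_twist (W' : WeierstrassCurve ℚ) [W'.IsElliptic] {C : VariableChange ℚ} {d : ℤ}
    {E : WeierstrassCurve ℚ} [E.IsElliptic] (hE : E = cm11 ∨ E = cm19 ∨ E = cm43 ∨ E = cm67 ∨ E = cm163)
    (hd0 : d ≠ 0) (hC : C • W' = E.quadraticTwist (d : ℚ)) :
    W'.HasCM ∧ CMInert W' 2 ∧ W'.HasSurjectiveModNGaloisRep 2 ∧ 1 ≤ padicValNat 2 W'.tamagawaProduct := by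
  refine shiftedHabitat_of_j_oddHeegner W' ?_
  rw [j_of_twist W' hd0 hC]
  rcases hE with rfl | rfl | rfl | rfl | rfl
  · exact Or.inl j_cm11
  · exact Or.inr (Or.inl j_cm19)
  · exact Or.inr (Or.inr (Or.inl j_cm43))
  · exact Or.inr (Or.inr (Or.inr (Or.inl j_cm67)))
  · exact Or.inr (Or.inr (Or.inr (Or.inr j_cm163)))

end Shifted

end Summit.BirchSwinnertonDyer.Rank1Residual.P2.OddHeegnerTwists

end
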